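import Literature.Analysis.FluidPDE.KatoLocalBoundedPicard
import HarnessLib

/-!
# The Picard (Oseen) scheme with a general bounded datum, in the sup norm

Analysis/FluidPDE definitions-layer file for the proof of the named fact
`Literature.Analysis.FluidPDE.bradshawGrujicKukavica2015_local_analyticity_radius`
(Bradshaw–Grujić–Kukavica 2015, Thm. 2.3, §3–§4; Grujić–Kukavica 1998, §2: the approximating
sequence `u⁽⁰⁾ = 0`, `u⁽ⁿ⁺¹⁾ = [data] - B(u⁽ⁿ⁾, u⁽ⁿ⁾)`). For a base time `s₀`, viscosity `ν = 1`
and a **time-dependent bounded datum** `DATA : ℝ → E → E` (in the application: the sum of the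
gradient part, the heat datum, the annular Duhamel terms and the forcing of the localised
equation) we define the **Picard iterates**

  `oseenPicard s₀ DATA 0 = 0`,  `oseenPicard s₀ DATA (n+1) (t) = DATA(t) - B¹_{s₀}(wₙ, wₙ)(t)`

(`B¹_{s₀} = oseenDuhamel 1 s₀`, the Oseen–Koch–Tataru bilinear term) and prove, in the sup norm
on the slab `(s₀, t₁) × E` under the smallness `C (2D₀) 2√(t₁ - s₀) ≤ 1/4` (`C` the constant of
`exists_norm_oseenDuhamel_le_mul`, `‖DATA‖ ≤ D₀`):

* `aestronglyMeasurable_uncurry_oseenPicard` — the iterates are jointly measurable on the slab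
  (`aestronglyMeasurable_uncurry_oseenDuhamel`, `KatoLocalBoundedPicard.lean`), hence iterable;
* `norm_oseenPicard_le` — `‖wₙ(t, x)‖ ≤ 2D₀`;
* `norm_oseenPicard_sub_le` — **convergence to a bounded fixed point**: if `v` is jointly
  measurable, `‖v‖ ≤ 2D₀` and `v(t) = DATA(t) - B¹_{s₀}(v, v)(t)` pointwise on the slab, then
  `‖wₙ(t,x) - v(t,x)‖ ≤ 4D₀ 2⁻ⁿ` (`B(w,w) - B(v,v) = B(w - v, w) + B(v, w - v)`,
  `oseenDuhamel_self_sub_self`, and the bilinear sup bound with one small factor).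

No completeness argument is needed on the real side: the fixed point is known in advance (the
Oseen representation of the localised classical solution); the iterates serve the complexified
scheme, whose `n`-th member continues `wₙ`.

## References

* Z. Grujić, I. Kukavica, J. Funct. Anal. 152 (1998), §2 (the approximating sequence).
  [GrujicKukavica1998]
* Z. Bradshaw, Z. Grujić, I. Kukavica, J. Differential Equations 259 (2015), §3. [BradshawGrujicKukavica2015]
* P. G. Lemarié-Rieusset, *The Navier–Stokes Problem in the 21st Century* (2016), Thm. 5.1
  (Oseen's scheme). [LemarieRieusset2016]
-/

noncomputable section

open MeasureTheory Set Function Filter Metric Real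
open _root_.Topology

namespace Literature.Analysis.FluidPDE

variable {E : Type*} [NormedAddCommGroup E] [InnerProductSpace ℝ E] [FiniteDimensional ℝ E]
  [MeasurableSpace E] [BorelSpace E]

/-! ### The iterates -/

/-- **The Picard iterates of the Oseen integral equation with a time-dependent datum**
(`ν = 1`, base time `s₀`): `w₀ = 0`, `wₙ₊₁(t) = DATA(t) - B¹_{s₀}(wₙ, wₙ)(t)`.
[cite: GrujicKukavica1998, §2] -/
def oseenPicard (s₀ : ℝ) (DATA : ℝ → E → E) : ℕ → ℝ → E → E
  | 0 => fun _ _ => 0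
  | n + 1 => fun t x =>
      DATA t x - oseenDuhamel 1 s₀ (oseenPicard s₀ DATA n) (oseenPicard s₀ DATA n) t x

/-- Unfolding lemma (`n = 0`). [folklore] -/
@[simp] theorem oseenPicard_zero (s₀ : ℝ) (DATA : ℝ → E → E) (t : ℝ) (x : E) :
    oseenPicard s₀ DATA 0 t x = 0 := rfl

/-- Unfolding lemma (successor). [folklore] -/
theorem oseenPicard_succ (s₀ : ℝ) (DATA : ℝ → E → E) (n : ℕ) (t : ℝ) (x : E) :
    oseenPicard s₀ DATA (n + 1) t x =
      DATA t x - oseenDuhamel 1 s₀ (oseenPicard s₀ DATA n) (oseenPicard s₀ DATA n) t x := rfl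

/-! ### Measurability and bounds along the iteration -/

section Scheme

variable {s₀ t₁ : ℝ} {DATA : ℝ → E → E} {D₀ C : ℝ}

/-- **Joint measurability and the uniform bound of the iterates**, proved together by induction:
under `C (2D₀) 2√(t₁-s₀) ≤ 1/4` (`C` any constant for which the bilinear sup bound holds) every
iterate is jointly measurable on `(s₀, t₁) × E` and bounded by `2D₀` there. [cite: LemarieRieusset2016, Thm. 5.1 (proof)] -/
theorem oseenPicard_measurable_and_bound
    (hD : AEStronglyMeasurable (uncurry DATA) ((volume : Measure (ℝ × E)).restrict (Ioo s₀ t₁ ×ˢ univ)))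
    (hD0 : 0 ≤ D₀) (hDb : ∀ t ∈ Ioo s₀ t₁, ∀ x, ‖DATA t x‖ ≤ D₀) (hC : 0 < C)
    (hCB : ∀ {u v : ℝ → E → E} {s t Mu Mv : ℝ}, s < t → 0 ≤ Mu → 0 ≤ Mv →
      (∀ τ ∈ Ioo s t, ∀ y, ‖u τ y‖ ≤ Mu) → (∀ τ ∈ Ioo s t, ∀ y, ‖v τ y‖ ≤ Mv) → ∀ x : E,
        ‖oseenDuhamel 1 s u v t x‖ ≤ C * Mu * Mv * (1 : ℝ) ^ (-(1 / 2 : ℝ)) * (2 * Real.sqrt (t - s)))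
    (hsmall : C * (2 * D₀) * (2 * Real.sqrt (t₁ - s₀)) ≤ 1 / 4) (n : ℕ) :
    AEStronglyMeasurable (uncurry (oseenPicard s₀ DATA n))
        ((volume : Measure (ℝ × E)).restrict (Ioo s₀ t₁ ×ˢ univ)) ∧
      ∀ t ∈ Ioo s₀ t₁, ∀ x, ‖oseenPicard s₀ DATA n t x‖ ≤ 2 * D₀ := by
  induction n with
  | zero =>
    refine ⟨?_, fun t _ x => by simp; positivity⟩
    exact (aestronglyMeasurable_const (b := (0 : E))).congr (Eventually.of_forall fun z => rfl)
  | succ n ih =>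
    obtain ⟨hmeas, hbd⟩ := ih
    have hB := aestronglyMeasurable_uncurry_oseenDuhamel (ν := 1) (s := s₀) (T := t₁) one_pos hmeas hmeas
      hbd hbd
    refine ⟨?_, fun t ht x => ?_⟩
    · have h : AEStronglyMeasurable (fun z : ℝ × E => DATA z.1 z.2 -
          oseenDuhamel 1 s₀ (oseenPicard s₀ DATA n) (oseenPicard s₀ DATA n) z.1 z.2)
          ((volume : Measure (ℝ × E)).restrict (Ioo s₀ t₁ ×ˢ univ)) := hD.sub hB
      exact h.congr (Eventually.of_forall fun z => rfl)
    · rw [oseenPicard_succ]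
      have hbd' : ∀ τ ∈ Ioo s₀ t, ∀ y, ‖oseenPicard s₀ DATA n τ y‖ ≤ 2 * D₀ := fun τ hτ y =>
        hbd τ ⟨hτ.1, hτ.2.trans ht.2⟩ y
      have h1 := hCB ht.1 (by positivity) (by positivity) hbd' hbd' x
      rw [Real.one_rpow, mul_one] at h1
      have hsq : Real.sqrt (t - s₀) ≤ Real.sqrt (t₁ - s₀) := Real.sqrt_le_sqrt (by linarith [ht.2])
      have h2 : C * (2 * D₀) * (2 * D₀) * (2 * Real.sqrt (t - s₀)) ≤ D₀ := by
        calc C * (2 * D₀) * (2 * D₀) * (2 * Real.sqrt (t - s₀))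
            ≤ C * (2 * D₀) * (2 * D₀) * (2 * Real.sqrt (t₁ - s₀)) := by gcongr
          _ = (C * (2 * D₀) * (2 * Real.sqrt (t₁ - s₀))) * (2 * D₀) := by ring
          _ ≤ (1 / 4) * (2 * D₀) := by gcongr
          _ ≤ D₀ := by linarith
      calc ‖DATA t x - oseenDuhamel 1 s₀ (oseenPicard s₀ DATA n) (oseenPicard s₀ DATA n) t x‖
          ≤ ‖DATA t x‖ + ‖oseenDuhamel 1 s₀ (oseenPicard s₀ DATA n) (oseenPicard s₀ DATA n) t x‖ :=
            norm_sub_le _ _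
        _ ≤ D₀ + D₀ := add_le_add (hDb t ht x) (h1.trans h2)
        _ = 2 * D₀ := by ring

/-- The iterates are jointly measurable on the slab. [folklore] -/
theorem aestronglyMeasurable_uncurry_oseenPicard
    (hD : AEStronglyMeasurable (uncurry DATA) ((volume : Measure (ℝ × E)).restrict (Ioo s₀ t₁ ×ˢ univ)))
    (hD0 : 0 ≤ D₀) (hDb : ∀ t ∈ Ioo s₀ t₁, ∀ x, ‖DATA t x‖ ≤ D₀) (hC : 0 < C)
    (hCB : ∀ {u v : ℝ → E → E} {s t Mu Mv : ℝ}, s < t → 0 ≤ Mu → 0 ≤ Mv →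
      (∀ τ ∈ Ioo s t, ∀ y, ‖u τ y‖ ≤ Mu) → (∀ τ ∈ Ioo s t, ∀ y, ‖v τ y‖ ≤ Mv) → ∀ x : E,
        ‖oseenDuhamel 1 s u v t x‖ ≤ C * Mu * Mv * (1 : ℝ) ^ (-(1 / 2 : ℝ)) * (2 * Real.sqrt (t - s)))
    (hsmall : C * (2 * D₀) * (2 * Real.sqrt (t₁ - s₀)) ≤ 1 / 4) (n : ℕ) :
    AEStronglyMeasurable (uncurry (oseenPicard s₀ DATA n))
      ((volume : Measure (ℝ × E)).restrict (Ioo s₀ t₁ ×ˢ univ)) :=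
  (oseenPicard_measurable_and_bound hD hD0 hDb hC hCB hsmall n).1

/-- **The iterates are bounded by `2D₀`** on the slab. [cite: LemarieRieusset2016, Thm. 5.1 (proof)] -/
theorem norm_oseenPicard_le
    (hD : AEStronglyMeasurable (uncurry DATA) ((volume : Measure (ℝ × E)).restrict (Ioo s₀ t₁ ×ˢ univ)))
    (hD0 : 0 ≤ D₀) (hDb : ∀ t ∈ Ioo s₀ t₁, ∀ x, ‖DATA t x‖ ≤ D₀) (hC : 0 < C)
    (hCB : ∀ {u v : ℝ → E → E} {s t Mu Mv : ℝ}, s < t → 0 ≤ Mu → 0 ≤ Mv →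
      (∀ τ ∈ Ioo s t, ∀ y, ‖u τ y‖ ≤ Mu) → (∀ τ ∈ Ioo s t, ∀ y, ‖v τ y‖ ≤ Mv) → ∀ x : E,
        ‖oseenDuhamel 1 s u v t x‖ ≤ C * Mu * Mv * (1 : ℝ) ^ (-(1 / 2 : ℝ)) * (2 * Real.sqrt (t - s)))
    (hsmall : C * (2 * D₀) * (2 * Real.sqrt (t₁ - s₀)) ≤ 1 / 4) (n : ℕ)
    {t : ℝ} (ht : t ∈ Ioo s₀ t₁) (x : E) :
    ‖oseenPicard s₀ DATA n t x‖ ≤ 2 * D₀ :=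
  (oseenPicard_measurable_and_bound hD hD0 hDb hC hCB hsmall n).2 t ht x

/-! ### Convergence to a bounded fixed point -/

/-- **Geometric convergence of the iterates to a bounded fixed point.** If `v` is jointly
measurable on the slab, bounded by `2D₀`, and solves `v(t) = DATA(t) - B¹_{s₀}(v,v)(t)` pointwise
on `(s₀, t₁) × E`, then `‖wₙ(t,x) - v(t,x)‖ ≤ 4D₀ 2⁻ⁿ` on the slab. [cite: LemarieRieusset2016, Thm. 5.1 (proof, the contraction estimate)] -/
theorem norm_oseenPicard_sub_le
    (hD : AEStronglyMeasurable (uncurry DATA) ((volume : Measure (ℝ × E)).restrict (Ioo s₀ t₁ ×ˢ univ)))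
    (hD0 : 0 ≤ D₀) (hDb : ∀ t ∈ Ioo s₀ t₁, ∀ x, ‖DATA t x‖ ≤ D₀) (hC : 0 < C)
    (hCB : ∀ {u v : ℝ → E → E} {s t Mu Mv : ℝ}, s < t → 0 ≤ Mu → 0 ≤ Mv →
      (∀ τ ∈ Ioo s t, ∀ y, ‖u τ y‖ ≤ Mu) → (∀ τ ∈ Ioo s t, ∀ y, ‖v τ y‖ ≤ Mv) → ∀ x : E,
        ‖oseenDuhamel 1 s u v t x‖ ≤ C * Mu * Mv * (1 : ℝ) ^ (-(1 / 2 : ℝ)) * (2 * Real.sqrt (t - s)))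
    (hsmall : C * (2 * D₀) * (2 * Real.sqrt (t₁ - s₀)) ≤ 1 / 4)
    {v : ℝ → E → E}
    (hv : AEStronglyMeasurable (uncurry v) ((volume : Measure (ℝ × E)).restrict (Ioo s₀ t₁ ×ˢ univ)))
    (hvb : ∀ t ∈ Ioo s₀ t₁, ∀ x, ‖v t x‖ ≤ 2 * D₀)
    (hfix : ∀ t ∈ Ioo s₀ t₁, ∀ x, v t x = DATA t x - oseenDuhamel 1 s₀ v v t x) (n : ℕ) :
    ∀ t ∈ Ioo s₀ t₁, ∀ x, ‖oseenPicard s₀ DATA n t x - v t x‖ ≤ 4 * D₀ * (1 / 2) ^ n := by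
  induction n with
  | zero =>
    intro t ht x
    rw [oseenPicard_zero, zero_sub, norm_neg, pow_zero, mul_one]
    linarith [hvb t ht x]
  | succ n ih =>
    intro t ht x
    obtain ⟨hmeas, hbd⟩ := oseenPicard_measurable_and_bound hD hD0 hDb hC hCB hsmall n
    set w := oseenPicard s₀ DATA n with hw
    -- restrict everything to the slab `(s₀, t)`
    have hsub : Ioo s₀ t ×ˢ (univ : Set E) ⊆ Ioo s₀ t₁ ×ˢ univ := prod_mono (Ioo_subset_Ioo_right ht.2.le) subset_rfl
    have hmeas_t : AEStronglyMeasurable (uncurry w) ((volume : Measure (ℝ × E)).restrict (Ioo s₀ t ×ˢ univ)) :=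
      hmeas.mono_measure (Measure.restrict_mono hsub le_rfl)
    have hv_t : AEStronglyMeasurable (uncurry v) ((volume : Measure (ℝ × E)).restrict (Ioo s₀ t ×ˢ univ)) :=
      hv.mono_measure (Measure.restrict_mono hsub le_rfl)
    have hbd_t : ∀ τ ∈ Ioo s₀ t, ∀ y, ‖w τ y‖ ≤ 2 * D₀ := fun τ hτ y => hbd τ ⟨hτ.1, hτ.2.trans ht.2⟩ y
    have hvb_t : ∀ τ ∈ Ioo s₀ t, ∀ y, ‖v τ y‖ ≤ 2 * D₀ := fun τ hτ y => hvb τ ⟨hτ.1, hτ.2.trans ht.2⟩ y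
    have hdiff_t : ∀ τ ∈ Ioo s₀ t, ∀ y, ‖w τ y - v τ y‖ ≤ 4 * D₀ * (1 / 2) ^ n := fun τ hτ y =>
      ih τ ⟨hτ.1, hτ.2.trans ht.2⟩ y
    -- the quadratic difference
    have hsplit := oseenDuhamel_self_sub_self (ν := 1) (s := s₀) (T := t) one_pos hmeas_t hv_t hbd_t hvb_t
      ht.1 le_rfl x
    have hδ0 : 0 ≤ 4 * D₀ * (1 / 2) ^ n := by positivity
    have h1 := hCB (u := fun τ y => w τ y - v τ y) (v := w) ht.1 hδ0 (by positivity) hdiff_t hbd_t x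
    have h2 := hCB (u := v) (v := fun τ y => w τ y - v τ y) ht.1 (by positivity) hδ0 hvb_t hdiff_t x
    rw [Real.one_rpow, mul_one] at h1 h2
    have hsq : Real.sqrt (t - s₀) ≤ Real.sqrt (t₁ - s₀) := Real.sqrt_le_sqrt (by linarith [ht.2])
    have e : oseenPicard s₀ DATA (n + 1) t x - v t x =
        -(oseenDuhamel 1 s₀ w w t x - oseenDuhamel 1 s₀ v v t x) := by
      rw [oseenPicard_succ, hfix t ht x, ← hw]; abel
    rw [e, norm_neg, hsplit]
    calc ‖oseenDuhamel 1 s₀ (fun τ y => w τ y - v τ y) w t x + oseenDuhamel 1 s₀ v (fun τ y => w τ y - v τ y) t x‖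
        ≤ C * (4 * D₀ * (1 / 2) ^ n) * (2 * D₀) * (2 * Real.sqrt (t - s₀)) +
          C * (2 * D₀) * (4 * D₀ * (1 / 2) ^ n) * (2 * Real.sqrt (t - s₀)) :=
          (norm_add_le _ _).trans (add_le_add h1 h2)
      _ = (4 * D₀ * (1 / 2) ^ n) * (2 * (C * (2 * D₀) * (2 * Real.sqrt (t - s₀)))) := by ring
      _ ≤ (4 * D₀ * (1 / 2) ^ n) * (2 * (C * (2 * D₀) * (2 * Real.sqrt (t₁ - s₀)))) := by gcongr
      _ ≤ (4 * D₀ * (1 / 2) ^ n) * (2 * (1 / 4)) := by gcongr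
      _ = 4 * D₀ * (1 / 2) ^ (n + 1) := by ring

end Scheme

end Literature.Analysis.FluidPDE
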